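import Literature.MathematicalPhysics.QuantumFieldTheory.Balaban1983to89.Beta.WoodburyBondSymbol

/-!
# Volume sockets: the `T ↗ ℤ^d` limits of the `U = 1` block kernels as `Filter.Tendsto` along the even cubic tori

HONEST SCOPE (page 1 of everything in this cell): discharging `BetaPertH` makes Bałaban's UV stability UNCONDITIONAL —
a real constructive-QFT result; it is NOT the continuum limit and NOT the Clay problem. This file is pure BOOKKEEPING
(Mathlib filters); it asserts nothing about Bałaban's propagators and discharges no analytic leaf.

WHAT IT IS FOR. The volume-limit seam of the scalar wall, `Beta/WallVolumeTransfer` (row an4), takes the pointwise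
infinite-volume limits of the finite-volume kernel entries as BINDERS of the shape
`Tendsto (fun t => GT n t v) l (𝓝 (Gf n v))` along an arbitrary index filter (its §2), and converts `ε–L₀` statements by its
§3 `tendsto_of_eps_volume`. The four `T ↗ ℤ^d` certificates of this lineage — the free leg (`FreeLegDictionary.torusFreeLeg_limit`),
the site Woodbury kernel (`WoodburySymbol.Rperp_tendsto_RperpLim`), the bond-block Woodbury kernel
(`WoodburyBondSymbol.RperpW_tendsto_RperpBLim`) and the longitudinal kernel (`LongitudinalSymbol.Lker_tendsto_LkerLim`) — are
stated in the `ε–m₀` form «`∀ ε > 0 ∃ m₀ ∀ m, Even m → m₀ ≤ m → ‖K_m − K_∞‖ ≤ ε`» over the even cubic coarse periods `m`. This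
file fixes ONE index sequence, the even cubic volume `m = evenPeriod t = 2(t+1)` (`t : ℕ`, filter `atTop`; B12 p.251: cubic
tori; lit1's Riemann sums: even periods), and delivers each limit as a `Tendsto` along it (complex-valued, plus the real parts),
so that the consumer adapter of the seam can `exact` them. The `(x, x′) ↦ (b, v)` reading of entries on `ℤ⁴` representatives,
the lattice-unit scaling and the `ℂ → ℝ` passage for the wall's real families are the CALLER's (they are `Tendsto.const_mul` /
`Complex.continuous_re` one-liners on top of these sockets) — nothing about them is claimed here.

WHAT IS PROVED ([folklore], zero `sorry`):
* §1 `evenPeriod t = 2(t+1)` with its `NeZero` instance, evenness, monotone growth, `tendsto_evenPeriod`;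
* §2 the two conversions `tendsto_evenPeriod_of_eps` (ℂ, `‖·‖`) / `tendsto_evenPeriod_of_eps_real` (ℝ, `|·|`) from the
  lineage's `ε–m₀` form (instance-dependent sequences `u : (m : ℕ) → [NeZero m] → _`) to `Tendsto … atTop (𝓝 a)`;
* §3 THE SOCKETS: `freeLeg_socket` (`torusFreeLeg n (2(t+1)) a z → G₀ z`, `d ≥ 3`), `Rperp_socket` (site Woodbury kernel →
  `RperpLim`, `d ≥ 3`), `RperpB_socket` (bond-block Woodbury kernel → `RperpBLim`, `d ≥ 3`), `Lker_socket` (longitudinal kernel →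
  `LkerLim`, every `d ≥ 1`), each at fixed block side `n ≥ 1` and fixed integer points, and their real parts `…_socket_re`;
* §4 BLOCK-TRANSLATION INVARIANCE of the three continuum symbols and hence of the three limit kernels on `ℕ^d × ℕ^d`:
  a common block translation `x ↦ x + n·z`, `x′ ↦ x′ + n·z` (`z ∈ ℕ^d`) multiplies the fibre amplitudes by the Bloch phase
  `e^{∓iθ·z}` (`phc_blockShift`, from `B5Block118.om_pow`: `ω_ν^n = e^{iθ_ν}` is alias-independent) and leaves `F`, `F^μ`, `F_𝓛`
  unchanged (`Fc_blockShift`, `FcB_blockShift`, `FL_blockShift`); so `RperpLim_blockShift`, `RperpBLim_blockShift`,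
  `LkerLim_blockShift` — the consistency fact the caller needs to READ the limit kernels at arbitrary pairs of `ℤ^d` points by
  shifting them into `ℕ^d` (this removes the «no translation covariance stated» caveat of the three symbol files for BLOCK
  translations; covariance under translations that are not multiples of the block side is not claimed and is false in general).

Citations: [Balaban1987RG1] = CMP 109 (1987) 249–301, p.251 (cubic tori) and p.264 (the `T ↗ ℤ^d` step) — CONTEXT for the
choice of the index sequence only; nothing is quoted as mathematics. Unit `b2b-balaban-beta-an5-g8` (DEDICATED β sub-cell row
BETA-an5 gen 8), node BETA-an5-g8-VOLUME-SOCKETS (GAPS G-an5g8-2 (β″)).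
-/

noncomputable section

open Filter Topology Complex
open scoped BigOperators ComplexConjugate

namespace Literature.MathematicalPhysics.QuantumFieldTheory.Balaban1983to89.Beta.BlockKernelVolumeSockets

open Literature.MathematicalPhysics.QuantumFieldTheory.Balaban1983to89.B5Prop11Plancherel (Tor fine)
open Literature.MathematicalPhysics.QuantumFieldTheory.Balaban1983to89.Beta.WoodburyFibre (Rperp)
open Literature.MathematicalPhysics.QuantumFieldTheory.Balaban1983to89.Beta.WoodburyCovariant (wt bondAvg RperpW)
open Literature.MathematicalPhysics.QuantumFieldTheory.Balaban1983to89.Beta.FreeLegDictionary (cubic torusFreeLeg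
  torusFreeLeg_limit)
open Literature.MathematicalPhysics.QuantumFieldTheory.Balaban1983to89.Beta.PoissonInterior (G₀)
open Literature.MathematicalPhysics.QuantumFieldTheory.Balaban1983to89.Beta.LongitudinalWindow (Lker)
open Literature.MathematicalPhysics.QuantumFieldTheory.Balaban1983to89.B5Block118 (om om_pow)
open Literature.MathematicalPhysics.QuantumFieldTheory.Balaban1983to89.Beta.WoodburySymbol (phc Ac kc Fc RperpLim
  Rperp_tendsto_RperpLim)
open Literature.MathematicalPhysics.QuantumFieldTheory.Balaban1983to89.Beta.WoodburyBondSymbol (AcB kcB FcB RperpBLim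
  RperpW_tendsto_RperpBLim)
open Literature.MathematicalPhysics.QuantumFieldTheory.Balaban1983to89.Beta.LongitudinalSymbol (cTc bc lampc FL LkerLim
  Lker_tendsto_LkerLim)

/-! ## §1 The even cubic volume index `m = 2(t+1)` -/

/-- the even cubic coarse period `2(t+1)` indexed by `t : ℕ` (even: lit1's Riemann sums; cubic: B12 p.251).
[cite: Balaban1987RG1, p.251 (context: cubic tori)] -/
def evenPeriod (t : ℕ) : ℕ := 2 * (t + 1)

/-- `2(t+1) ≠ 0`, as an instance (so that the tori `Tor (fine n (cubic d (evenPeriod t)))` typecheck). [folklore] -/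
instance neZero_evenPeriod (t : ℕ) : NeZero (evenPeriod t) := ⟨by unfold evenPeriod; omega⟩

/-- `2(t+1)` is even. [folklore] -/
theorem even_evenPeriod (t : ℕ) : Even (evenPeriod t) := ⟨t + 1, by unfold evenPeriod; ring⟩

/-- `t + 1 ≤ 2(t+1)`. [folklore] -/
theorem succ_le_evenPeriod (t : ℕ) : t + 1 ≤ evenPeriod t := by unfold evenPeriod; omega

/-- the even cubic volume tends to infinity. [folklore] -/
theorem tendsto_evenPeriod : Tendsto evenPeriod atTop atTop :=
  tendsto_atTop_mono succ_le_evenPeriod (tendsto_add_atTop_nat 1)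

/-! ## §2 From the lineage's `ε–m₀` form to `Tendsto` along `evenPeriod` -/

/-- **CONVERSION (complex)**: `∀ ε > 0 ∃ m₀ ∀ m ≠ 0, Even m → m₀ ≤ m → ‖u_m − a‖ ≤ ε` ⟹ `u_{2(t+1)} → a`. The sequence may
depend on the `NeZero m` instance (torus-indexed kernels do). [folklore] -/
theorem tendsto_evenPeriod_of_eps {u : (m : ℕ) → [NeZero m] → ℂ} {a : ℂ}
    (h : ∀ ε : ℝ, 0 < ε → ∃ m₀ : ℕ, ∀ (m : ℕ) [NeZero m], Even m → m₀ ≤ m → ‖u m - a‖ ≤ ε) :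
    Tendsto (fun t => u (evenPeriod t)) atTop (𝓝 a) := by
  rw [Metric.tendsto_atTop]
  intro ε hε
  obtain ⟨m₀, hm₀⟩ := h (ε / 2) (half_pos hε)
  refine ⟨m₀, fun t ht => ?_⟩
  rw [dist_eq_norm]
  have hle : m₀ ≤ evenPeriod t := le_trans ht (le_trans (Nat.le_succ t) (succ_le_evenPeriod t))
  exact (hm₀ (evenPeriod t) (even_evenPeriod t) hle).trans_lt (half_lt_self hε)

/-- **CONVERSION (real)**: the same with `|·|`. [folklore] -/
theorem tendsto_evenPeriod_of_eps_real {u : (m : ℕ) → [NeZero m] → ℝ} {a : ℝ}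
    (h : ∀ ε : ℝ, 0 < ε → ∃ m₀ : ℕ, ∀ (m : ℕ) [NeZero m], Even m → m₀ ≤ m → |u m - a| ≤ ε) :
    Tendsto (fun t => u (evenPeriod t)) atTop (𝓝 a) := by
  rw [Metric.tendsto_atTop]
  intro ε hε
  obtain ⟨m₀, hm₀⟩ := h (ε / 2) (half_pos hε)
  refine ⟨m₀, fun t ht => ?_⟩
  rw [Real.dist_eq]
  have hle : m₀ ≤ evenPeriod t := le_trans ht (le_trans (Nat.le_succ t) (succ_le_evenPeriod t))
  exact (hm₀ (evenPeriod t) (even_evenPeriod t) hle).trans_lt (half_lt_self hε)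

/-! ## §3 The sockets -/

variable {d : ℕ} (n : ℕ) [NeZero n]

/-- **FREE-LEG SOCKET** (`d ≥ 3`, block side `n ≥ 1`, `a > 0`, `z ∈ ℤ^d`): the torus free leg in lattice units on the even
cubic torus of fine period `n·2(t+1)` tends to the `ℤ^d` free leg `G₀(z)` — `FreeLegDictionary.torusFreeLeg_limit` along
`evenPeriod`. [folklore] -/
theorem freeLeg_socket (hd : 3 ≤ d) (hn : 1 ≤ n) {a : ℝ} (ha : 0 < a) (z : Fin d → ℤ) :
    Tendsto (fun t => torusFreeLeg n (evenPeriod t) a z) atTop (𝓝 (G₀ z)) := by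
  rw [Metric.tendsto_atTop]
  intro ε hε
  obtain ⟨L₀, hL₀⟩ := torusFreeLeg_limit (d := d) hd ha z (half_pos hε)
  refine ⟨L₀, fun t ht => ?_⟩
  rw [Real.dist_eq]
  have hev : Even (n * evenPeriod t) := (even_evenPeriod t).mul_left n
  have hle : L₀ ≤ n * evenPeriod t :=
    le_trans ht (le_trans (le_trans (Nat.le_succ t) (succ_le_evenPeriod t))
      (Nat.le_mul_of_pos_left _ (by omega)))
  exact (hL₀ n (evenPeriod t) hev hle).trans_lt (half_lt_self hε)

/-- **SITE WOODBURY SOCKET** (`d ≥ 3`, `n ≥ 1`, `a > 0`, `m² ≥ 0`, integer points `x, x′`): `R⊥_{n,(2(t+1),…)}(x̂, x̂′) → R⊥_∞(x, x′)`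
— `WoodburySymbol.Rperp_tendsto_RperpLim` along `evenPeriod`. [folklore] -/
theorem Rperp_socket (hd : 3 ≤ d) (hn : 1 ≤ n) {a m2 : ℝ} (ha : 0 < a) (hm2 : 0 ≤ m2) (x x' : Fin d → ℕ) :
    Tendsto (fun t => Rperp n (cubic d (evenPeriod t)) a m2 (WoodburySymbol.emb n (evenPeriod t) x)
      (WoodburySymbol.emb n (evenPeriod t) x')) atTop (𝓝 (RperpLim n a m2 x x')) :=
  tendsto_evenPeriod_of_eps
    (u := fun m _ => Rperp n (cubic d m) a m2 (WoodburySymbol.emb n m x) (WoodburySymbol.emb n m x'))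
    fun _ hε => Rperp_tendsto_RperpLim n hd hn ha hm2 x x' hε

/-- **BOND-BLOCK WOODBURY SOCKET** (`d ≥ 3`): `R⊥_{u·v_μ; n,(2(t+1),…)}(x̂, x̂′) → R⊥_{w,∞}(x, x′)` —
`WoodburyBondSymbol.RperpW_tendsto_RperpBLim` along `evenPeriod`. [folklore] -/
theorem RperpB_socket (hd : 3 ≤ d) (hn : 1 ≤ n) {a m2 : ℝ} (ha : 0 < a) (hm2 : 0 ≤ m2) (μ : Fin d)
    (x x' : Fin d → ℕ) :
    Tendsto (fun t => RperpW n (cubic d (evenPeriod t)) (wt n (cubic d (evenPeriod t))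
        (bondAvg n (cubic d (evenPeriod t)) μ)) a m2 (WoodburySymbol.emb n (evenPeriod t) x)
        (WoodburySymbol.emb n (evenPeriod t) x')) atTop (𝓝 (RperpBLim n a m2 μ x x')) :=
  tendsto_evenPeriod_of_eps
    (u := fun m _ => RperpW n (cubic d m) (wt n (cubic d m) (bondAvg n (cubic d m) μ)) a m2
      (WoodburySymbol.emb n m x) (WoodburySymbol.emb n m x'))
    fun _ hε => RperpW_tendsto_RperpBLim n hd hn ha hm2 μ x x' hε

/-- **LONGITUDINAL SOCKET** (every `d ≥ 1`, `n ≥ 1`, `a > 0`): `𝓛_{n,(2(t+1),…)}((x̂,μ),(x̂′,ν)) → 𝓛_∞((x,μ),(x′,ν))` —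
`LongitudinalSymbol.Lker_tendsto_LkerLim` along `evenPeriod`. [folklore] -/
theorem Lker_socket (hd : 0 < d) (hn : 1 ≤ n) {a : ℝ} (ha : 0 < a) (x : Fin d → ℕ) (μ : Fin d) (x' : Fin d → ℕ)
    (ν : Fin d) :
    Tendsto (fun t => Lker n hn (cubic d (evenPeriod t)) a ha (WoodburySymbol.emb n (evenPeriod t) x) μ
      (WoodburySymbol.emb n (evenPeriod t) x') ν) atTop (𝓝 (LkerLim n a x μ x' ν)) :=
  tendsto_evenPeriod_of_eps
    (u := fun m _ => Lker n hn (cubic d m) a ha (WoodburySymbol.emb n m x) μ (WoodburySymbol.emb n m x') ν)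
    fun _ hε => Lker_tendsto_LkerLim n hd hn ha x μ x' ν hε

/-! ### Real parts (the wall's families are real-valued; `Complex.continuous_re` composed once) -/

/-- real part of the site Woodbury socket. [folklore] -/
theorem Rperp_socket_re (hd : 3 ≤ d) (hn : 1 ≤ n) {a m2 : ℝ} (ha : 0 < a) (hm2 : 0 ≤ m2) (x x' : Fin d → ℕ) :
    Tendsto (fun t => (Rperp n (cubic d (evenPeriod t)) a m2 (WoodburySymbol.emb n (evenPeriod t) x)
      (WoodburySymbol.emb n (evenPeriod t) x')).re) atTop (𝓝 (RperpLim n a m2 x x').re) :=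
  (Complex.continuous_re.tendsto _).comp (Rperp_socket n hd hn ha hm2 x x')

/-- real part of the bond-block Woodbury socket. [folklore] -/
theorem RperpB_socket_re (hd : 3 ≤ d) (hn : 1 ≤ n) {a m2 : ℝ} (ha : 0 < a) (hm2 : 0 ≤ m2) (μ : Fin d)
    (x x' : Fin d → ℕ) :
    Tendsto (fun t => (RperpW n (cubic d (evenPeriod t)) (wt n (cubic d (evenPeriod t))
        (bondAvg n (cubic d (evenPeriod t)) μ)) a m2 (WoodburySymbol.emb n (evenPeriod t) x)
        (WoodburySymbol.emb n (evenPeriod t) x')).re) atTop (𝓝 (RperpBLim n a m2 μ x x').re) :=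
  (Complex.continuous_re.tendsto _).comp (RperpB_socket n hd hn ha hm2 μ x x')

/-- real part of the longitudinal socket. [folklore] -/
theorem Lker_socket_re (hd : 0 < d) (hn : 1 ≤ n) {a : ℝ} (ha : 0 < a) (x : Fin d → ℕ) (μ : Fin d) (x' : Fin d → ℕ)
    (ν : Fin d) :
    Tendsto (fun t => (Lker n hn (cubic d (evenPeriod t)) a ha (WoodburySymbol.emb n (evenPeriod t) x) μ
      (WoodburySymbol.emb n (evenPeriod t) x') ν).re) atTop (𝓝 (LkerLim n a x μ x' ν).re) :=
  (Complex.continuous_re.tendsto _).comp (Lker_socket n hd hn ha x μ x' ν)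


/-! ## §4 Block-translation invariance of the symbols and of the limit kernels -/

/-- the Bloch phase of a block translation. [folklore] -/
def blochPhase (θ : Fin d → ℝ) (z : Fin d → ℕ) : ℂ := ∏ ν, Complex.exp (((θ ν : ℝ) : ℂ) * I) ^ (z ν)

omit [NeZero n] in
/-- `|e^{iθ·z}| = 1`. [folklore] -/
theorem norm_blochPhase (θ : Fin d → ℝ) (z : Fin d → ℕ) : ‖blochPhase θ z‖ = 1 := by
  unfold blochPhase
  rw [norm_prod]
  exact Finset.prod_eq_one fun ν _ => by rw [norm_pow, Complex.norm_exp_ofReal_mul_I, one_pow]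

omit [NeZero n] in
/-- `conj(e^{iθ·z}) · e^{iθ·z} = 1`. [folklore] -/
theorem conj_blochPhase_mul_self (θ : Fin d → ℝ) (z : Fin d → ℕ) :
    conj (blochPhase θ z) * blochPhase θ z = 1 := by
  rw [← Complex.normSq_eq_conj_mul_self, Complex.normSq_eq_norm_sq, norm_blochPhase]
  simp

/-- **`phc` under a block translation**: `Π_ν ω_ν^{x_ν + n z_ν} = (Π_ν ω_ν^{x_ν}) · e^{iθ·z}` — the extra factor
`ω_ν^{n z_ν} = e^{iθ_ν z_ν}` does not depend on the alias index (`B5Block118.om_pow`). [folklore] -/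
theorem phc_blockShift (k : Fin d → Fin n) (θ : Fin d → ℝ) (x z : Fin d → ℕ) :
    phc n k θ (x + n • z) = phc n k θ x * blochPhase θ z := by
  unfold phc blochPhase
  rw [← Finset.prod_mul_distrib]
  refine Finset.prod_congr rfl fun ν _ => ?_
  rw [Pi.add_apply, Pi.smul_apply, smul_eq_mul, pow_add, pow_mul, om_pow]

/-- the site fibre amplitude picks up `conj e^{iθ·z}`. [folklore] -/
theorem Ac_blockShift (m2 : ℝ) (x z : Fin d → ℕ) (θ : Fin d → ℝ) :
    Ac n m2 (x + n • z) θ = conj (blochPhase θ z) * Ac n m2 x θ := by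
  unfold Ac
  rw [Finset.mul_sum]
  refine Finset.sum_congr rfl fun k _ => ?_
  rw [phc_blockShift, map_mul]
  ring

/-- **THE SITE SYMBOL IS BLOCK-TRANSLATION INVARIANT**: `F(θ; x + nz, x′ + nz) = F(θ; x, x′)`. [folklore] -/
theorem Fc_blockShift (a m2 : ℝ) (x x' z : Fin d → ℕ) (θ : Fin d → ℝ) :
    Fc n a m2 (x + n • z) (x' + n • z) θ = Fc n a m2 x x' θ := by
  unfold Fc
  rw [Ac_blockShift, Ac_blockShift, map_mul, Complex.conj_conj]
  linear_combination (kc n a m2 θ : ℂ) * Ac n m2 x θ * conj (Ac n m2 x' θ) * conj_blochPhase_mul_self θ z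

/-- **`R⊥_∞(x + nz, x′ + nz) = R⊥_∞(x, x′)`** (site Woodbury limit kernel). [folklore] -/
theorem RperpLim_blockShift (a m2 : ℝ) (x x' z : Fin d → ℕ) :
    RperpLim n a m2 (x + n • z) (x' + n • z) = RperpLim n a m2 x x' := by
  simp only [RperpLim, Fc_blockShift]

/-- the bond fibre amplitude picks up `conj e^{iθ·z}`. [folklore] -/
theorem AcB_blockShift (m2 : ℝ) (μ : Fin d) (x z : Fin d → ℕ) (θ : Fin d → ℝ) :
    AcB n m2 μ (x + n • z) θ = conj (blochPhase θ z) * AcB n m2 μ x θ := by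
  unfold AcB
  rw [Finset.mul_sum]
  refine Finset.sum_congr rfl fun k _ => ?_
  rw [phc_blockShift, map_mul]
  ring

/-- **THE BOND SYMBOL IS BLOCK-TRANSLATION INVARIANT**: `F^μ(θ; x + nz, x′ + nz) = F^μ(θ; x, x′)`. [folklore] -/
theorem FcB_blockShift (a m2 : ℝ) (μ : Fin d) (x x' z : Fin d → ℕ) (θ : Fin d → ℝ) :
    FcB n a m2 μ (x + n • z) (x' + n • z) θ = FcB n a m2 μ x x' θ := by
  unfold FcB
  rw [AcB_blockShift, AcB_blockShift, map_mul, Complex.conj_conj]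
  linear_combination (kcB n a m2 μ θ : ℂ) * AcB n m2 μ x θ * conj (AcB n m2 μ x' θ) * conj_blochPhase_mul_self θ z

/-- **`R⊥_{w,∞}(x + nz, x′ + nz) = R⊥_{w,∞}(x, x′)`** (bond-block Woodbury limit kernel). [folklore] -/
theorem RperpBLim_blockShift (a m2 : ℝ) (μ : Fin d) (x x' z : Fin d → ℕ) :
    RperpBLim n a m2 μ (x + n • z) (x' + n • z) = RperpBLim n a m2 μ x x' := by
  simp only [RperpBLim, FcB_blockShift]

/-- the leg amplitude of line 3 picks up `e^{iθ·z}`. [folklore] -/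
theorem lampc_blockShift (a : ℝ) (θ : Fin d → ℝ) (x z : Fin d → ℕ) (μ : Fin d) :
    lampc n a θ (x + n • z) μ = blochPhase θ z * lampc n a θ x μ := by
  unfold lampc
  rw [Finset.mul_sum]
  refine Finset.sum_congr rfl fun k _ => ?_
  rw [phc_blockShift]
  ring

/-- **THE LINE-3 SYMBOL IS BLOCK-TRANSLATION INVARIANT**: `F_𝓛(θ; (x+nz,μ),(x′+nz,ν)) = F_𝓛(θ; (x,μ),(x′,ν))`. [folklore] -/
theorem FL_blockShift (a : ℝ) (x : Fin d → ℕ) (μ : Fin d) (x' : Fin d → ℕ) (ν : Fin d) (z : Fin d → ℕ)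
    (θ : Fin d → ℝ) : FL n a (x + n • z) μ (x' + n • z) ν θ = FL n a x μ x' ν θ := by
  unfold FL
  rw [lampc_blockShift, lampc_blockShift, map_mul]
  linear_combination cTc n a θ * (lampc n a θ x μ * conj (lampc n a θ x' ν)) * conj_blochPhase_mul_self θ z

/-- **`𝓛_∞((x+nz,μ),(x′+nz,ν)) = 𝓛_∞((x,μ),(x′,ν))`** (longitudinal limit kernel). [folklore] -/
theorem LkerLim_blockShift (a : ℝ) (x : Fin d → ℕ) (μ : Fin d) (x' : Fin d → ℕ) (ν : Fin d) (z : Fin d → ℕ) :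
    LkerLim n a (x + n • z) μ (x' + n • z) ν = LkerLim n a x μ x' ν := by
  simp only [LkerLim, FL_blockShift]

end Literature.MathematicalPhysics.QuantumFieldTheory.Balaban1983to89.Beta.BlockKernelVolumeSockets
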